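import Mathlib.Data.Fintype.Perm
import Mathlib.Combinatorics.Colex
import Summits.CriticalPhenomena.PercolationContinuityZ3.Theorems.PercNearOneGluingNoHeavyLowerTailSahiCTCN2FiveTab
import Summits.CriticalPhenomena.PercolationContinuityZ3.Theorems.PercNearOneGluingNoHeavyLowerTailSahiCTCN2Symm
import HarnessLib

/-!
# `NoHeavyLowerTail` (crux stmt-CriticalPhenomena-4575), P3 lane: **the c = 2 coefficientwise threshold certificate on FIVE points** —
# `Ñ₂(K_X, K_Z) ∈ ℕ[r]` for EVERY pair of simplicial complexes on `Fin 5` (kernel-checked finite enumeration)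

Support file (seat `prim-l12-p3`, gen 20; `--supports stmt-CriticalPhenomena-4575`; `--computational`: one `native_decide` enumeration and two
small coding facts).  Memo `run/shared/lean/prim/prim-l12/FROM-prim-l12-p3-g20-*.md`.

**THEOREM `coeff_N2gen_nonneg_fin5`.**  For all down-sets `K_X, K_Z ⊆ 2^{Fin 5}` containing `∅`, every coefficient of the generic c = 2 certificate
polynomial `Ñ₂(K_X,K_Z)` (`…SahiCTCReduction.N2gen`, g9's form (A) of the `(TC)` row of the threshold certificate `ρ₂ = μ(· | exactly two closed)`)
is `≥ 0`.  This is the conjecture (CTC) of the programme (memo g9 §1) at `k = 5`, `c = 2` — the case of the majority-of-five first slot.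
PROOF.  `…SahiCTCN2Monotone.coeff_N2gen_nonneg_of_configs` reduces to flag configurations `(L_X, L_Z, A, B)`; these are coded by bit masks
(`encS`, `encE`), relabelling by `S₅` and the swap `X ↔ Z` act on codes through precomputed tables (`permTabs`), and `checkAll` verifies — for every
valid code that is lexicographically minimal in its orbit (`isCanon`) — that the coefficient table `…SahiCTCN2FiveTab.n2Tab` of the configuration is
entrywise `≥ 0` (`67 771` valid codes, `500` canonical ones, `3125` coefficients each; `checkAll_eq_true` by `native_decide`, ≈ 1 min).  Soundness
(`flagGood_of_code`) is a strong induction on the code: a non-canonical configuration has a relabelling (or swapped relabelling) with a smaller code,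
and nonnegativity transfers back by `…SahiCTCN2Symm.flagGood_of_map` / `flagGood_swap`.  Nothing is asserted about the crux.
-/

namespace Summit.CriticalPhenomena.PercolationContinuityZ3.Theorems.SahiCTCForms

open Finset MvPolynomial SahiCTCGenFun

namespace N2Five

/-! ### Codes of vertex sets and edge sets -/

/-- The subset of `Fin 5` with bit mask `m`. [this work] -/
def decodeSet (m : ℕ) : Finset (Fin 5) := univ.filter fun i => m.testBit (i : ℕ)

/-- The ten 2-subsets of `Fin 5` in the order `{i,j} ↦ j(j−1)/2 + i`. [this work] -/
def pairList : List (Finset (Fin 5)) := [{0, 1}, {0, 2}, {1, 2}, {0, 3}, {1, 3}, {2, 3}, {0, 4}, {1, 4}, {2, 4}, {3, 4}]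

/-- The `t`-th pair (junk `∅` out of range). [this work] -/
def pairAt (t : ℕ) : Finset (Fin 5) := pairList.getD t ∅

/-- The bit positions of an edge set. [this work] -/
def idxE (E : Finset (Finset (Fin 5))) : Finset ℕ := (range 10).filter fun t => pairAt t ∈ E

/-- The bit code of an edge set. [this work] -/
def encE (E : Finset (Finset (Fin 5))) : ℕ := ∑ t ∈ idxE E, 2 ^ t

/-- The edge set with bit code `a`. [this work] -/
def decodeEdges (a : ℕ) : Finset (Finset (Fin 5)) := ((range 10).filter fun t => a.testBit t).image pairAt

/-- The bit positions of a vertex set. [this work] -/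
def idxS (S : Finset (Fin 5)) : Finset ℕ := S.map Fin.valEmbedding

/-- `encS` through `idxS`. [this work] -/
theorem encS_eq (S : Finset (Fin 5)) : encS S = ∑ t ∈ idxS S, 2 ^ t := by
  unfold encS idxS; rw [sum_map]; rfl

/-- Bits of a power sum. [folklore] -/
theorem testBit_sum_two_pow (s : Finset ℕ) (i : ℕ) : (∑ t ∈ s, 2 ^ t).testBit i ↔ i ∈ s := by
  rw [← Nat.mem_bitIndices, ← List.mem_toFinset, Finset.toFinset_bitIndices_sum_two_pow]

/-- Bits of `encS`. [this work] -/
theorem testBit_encS (S : Finset (Fin 5)) (i : ℕ) : (encS S).testBit i ↔ i ∈ idxS S := by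
  rw [encS_eq, testBit_sum_two_pow]

/-- Bits of `encE`. [this work] -/
theorem testBit_encE (E : Finset (Finset (Fin 5))) (i : ℕ) : (encE E).testBit i ↔ i ∈ idxE E := by
  rw [encE, testBit_sum_two_pow]

/-- CODING FACT 1: `decodeSet ∘ encS = id`, codes `< 32`. [this work] -/
theorem decodeSet_encS : ∀ S : Finset (Fin 5), decodeSet (encS S) = S ∧ encS S < 32 := by native_decide

/-- CODING FACT 2: every 2-subset of `Fin 5` is listed. [this work] -/
theorem exists_pairAt : ∀ e ∈ pairsIn (univ : Finset (Fin 5)), ∃ t ∈ range 10, pairAt t = e := by native_decide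

/-- Edge codes are `< 1024`. [this work] -/
theorem encE_lt (E : Finset (Finset (Fin 5))) : encE E < 1024 := by
  refine Nat.lt_pow_two_of_testBit (n := 10) _ fun i hi => ?_
  rw [Bool.eq_false_iff, ne_eq, testBit_encE]
  intro h
  have := mem_range.1 (mem_filter.1 h).1
  omega

/-- Edge sets inside `pairs(B)` are sets of 2-subsets. [this work] -/
theorem subset_pairsIn_univ {A : Finset (Finset (Fin 5))} {B : Finset (Fin 5)} (h : A ⊆ pairsIn B) :
    A ⊆ pairsIn (univ : Finset (Fin 5)) := fun e he => by
  have := mem_filter.1 (h he)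
  exact mem_filter.2 ⟨this.1, this.2.1, subset_univ _⟩

/-- `decodeEdges ∘ encE = id` on sets of 2-subsets. [this work] -/
theorem decodeEdges_encE {E : Finset (Finset (Fin 5))} (hE : E ⊆ pairsIn (univ : Finset (Fin 5))) : decodeEdges (encE E) = E := by
  ext e
  simp only [decodeEdges, mem_image, mem_filter, mem_range, testBit_encE, idxE]
  constructor
  · rintro ⟨t, ⟨_, _, ht⟩, rfl⟩; exact ht
  · intro he
    obtain ⟨t, ht, rfl⟩ := exists_pairAt _ (hE he)
    exact ⟨t, ⟨mem_range.1 ht, mem_range.1 ht, he⟩, rfl⟩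

/-! ### Mask identities of a valid configuration -/

/-- `x ||| y = z` bitwise. [folklore] -/
theorem or_eq_of_testBit {x y z : ℕ} (h : ∀ i, (x.testBit i || y.testBit i) = z.testBit i) : x ||| y = z :=
  Nat.eq_of_testBit_eq fun i => by rw [Nat.testBit_or, h i]

/-- `L_X ∪ L_Z = univ` in codes. [this work] -/
theorem mask_union {LX LZ : Finset (Fin 5)} (h : LX ∪ LZ = univ) : encS LX ||| encS LZ = 31 := by
  refine or_eq_of_testBit fun i => ?_
  rw [show (31 : ℕ) = 2 ^ 5 - 1 from rfl, Nat.testBit_two_pow_sub_one]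
  by_cases hi : i < 5
  · rw [decide_eq_true hi]
    apply Bool.eq_iff_iff.2
    rw [Bool.or_eq_true_iff, testBit_encS, testBit_encS]
    refine ⟨fun _ => rfl, fun _ => ?_⟩
    have : (⟨i, hi⟩ : Fin 5) ∈ LX ∪ LZ := h ▸ mem_univ _
    rcases mem_union.1 this with h' | h'
    · exact Or.inl (mem_map.2 ⟨_, h', rfl⟩)
    · exact Or.inr (mem_map.2 ⟨_, h', rfl⟩)
  · rw [decide_eq_false hi]
    have hx : ∀ S : Finset (Fin 5), (encS S).testBit i = false := fun S => by
      rw [Bool.eq_false_iff, ne_eq, testBit_encS]; intro hm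
      obtain ⟨j, _, hj⟩ := mem_map.1 hm
      exact hi (hj ▸ j.isLt)
    rw [hx, hx]; rfl

/-- Subfamilies have sub-masks. [this work] -/
theorem mask_subset {A P : Finset (Finset (Fin 5))} (h : A ⊆ P) : encE A ||| encE P = encE P := by
  refine or_eq_of_testBit fun i => ?_
  rcases Bool.eq_false_or_eq_true ((encE A).testBit i) with hA | hA
  · have hP : (encE P).testBit i = true := by
      rw [testBit_encE] at hA ⊢; exact mem_filter.2 ⟨(mem_filter.1 hA).1, h (mem_filter.1 hA).2⟩
    rw [hA, hP]; rfl
  · rw [hA]; exact Bool.false_or _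

/-- A cover `P ⊆ A ∪ B` by subfamilies in codes. [this work] -/
theorem mask_cover {A B P : Finset (Finset (Fin 5))} (hA : A ⊆ P) (hB : B ⊆ P) (h : P ⊆ A ∪ B) : encE A ||| encE B = encE P := by
  refine or_eq_of_testBit fun i => ?_
  apply Bool.eq_iff_iff.2
  rw [Bool.or_eq_true_iff]
  simp only [testBit_encE, idxE, mem_filter]
  constructor
  · rintro (⟨hi, hm⟩ | ⟨hi, hm⟩)
    · exact ⟨hi, hA hm⟩
    · exact ⟨hi, hB hm⟩
  · rintro ⟨hi, hm⟩
    rcases mem_union.1 (h hm) with h' | h'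
    · exact Or.inl ⟨hi, h'⟩
    · exact Or.inr ⟨hi, h'⟩

/-! ### Configurations, the canonical filter, the enumeration -/

/-- The `X`-complex coded by `(lx, lz, a)`. [this work] -/
def cxX (lx lz a : ℕ) : Finset (Finset (Fin 5)) := flagCx (decodeSet lx) (privPairs (decodeSet lx) (decodeSet lz) ∪ decodeEdges a)

/-- The `Z`-complex coded by `(lx, lz, b)`. [this work] -/
def cxZ (lx lz b : ℕ) : Finset (Finset (Fin 5)) := flagCx (decodeSet lz) (privPairs (decodeSet lz) (decodeSet lx) ∪ decodeEdges b)

/-- The table check of one coded configuration. [this work] -/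
def checkConfig (lx lz a b : ℕ) : Bool := tabNonneg (n2Tab (cxX lx lz a) (cxZ lx lz b))

/-- The code of the common pairs of a live pattern, tabulated. [this work] -/
def bothTab : Array ℕ := Array.ofFn (n := 1024) fun c => encE (pairsIn (decodeSet (c.val / 32) ∩ decodeSet (c.val % 32)))

/-- The single numeric code of a configuration (lexicographic in `lx, lz, a, b`). [this work] -/
def code (lx lz a b : ℕ) : ℕ := ((lx * 32 + lz) * 1024 + a) * 1024 + b

/-- The relabellings used by the canonical filter. [this work] -/
def perms : List (Equiv.Perm (Fin 5)) := permsOfList (List.finRange 5)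

/-- Vertex-mask and edge-mask image tables of a relabelling. [this work] -/
def permTab (σ : Equiv.Perm (Fin 5)) : Array ℕ × Array ℕ :=
  (Array.ofFn (n := 32) fun m => encS ((decodeSet m.val).map σ.toEmbedding),
   Array.ofFn (n := 1024) fun a => encE ((decodeEdges a.val).map σ.finsetCongr.toEmbedding))

/-- All image tables. [this work] -/
def permTabs : List (Array ℕ × Array ℕ) := perms.map permTab

/-- The configuration code is minimal in its orbit under relabellings and the swap. [this work] -/
def isCanon (lx lz a b : ℕ) : Bool :=
  permTabs.all fun T =>
    decide (code lx lz a b ≤ code (T.1.getD lx 0) (T.1.getD lz 0) (T.2.getD a 0) (T.2.getD b 0)) &&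
    decide (code lx lz a b ≤ code (T.1.getD lz 0) (T.1.getD lx 0) (T.2.getD b 0) (T.2.getD a 0))

/-- Check a configuration if it is canonical. [this work] -/
def checkIfCanon (lx lz a b : ℕ) : Bool := if isCanon lx lz a b = true then checkConfig lx lz a b else true

/-- **The enumeration**: all valid configuration codes pass `checkIfCanon`. [this work] -/
def checkAll : Bool :=
  (List.range 32).all fun lx => (List.range 32).all fun lz =>
    if lx ||| lz = 31 then
      (List.range 1024).all fun a =>
        if a ||| bothTab.getD (lx * 32 + lz) 0 = bothTab.getD (lx * 32 + lz) 0 then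
          (List.range 1024).all fun b =>
            if b ||| bothTab.getD (lx * 32 + lz) 0 = bothTab.getD (lx * 32 + lz) 0 ∧ a ||| b = bothTab.getD (lx * 32 + lz) 0 then
              checkIfCanon lx lz a b else true
        else true
    else true

/-- **THE FINITE CHECK** (`67 771` valid codes, `500` canonical, `3125` coefficients each). [this work] -/
theorem checkAll_eq_true : checkAll = true := by native_decide

/-- Unpacking the enumeration. [this work] -/
theorem checkConfig_of_checkAll {lx lz a b : ℕ} (hlx : lx < 32) (hlz : lz < 32) (ha : a < 1024) (hb : b < 1024) (h1 : lx ||| lz = 31)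
    (h2 : a ||| bothTab.getD (lx * 32 + lz) 0 = bothTab.getD (lx * 32 + lz) 0)
    (h3 : b ||| bothTab.getD (lx * 32 + lz) 0 = bothTab.getD (lx * 32 + lz) 0) (h4 : a ||| b = bothTab.getD (lx * 32 + lz) 0)
    (hc : isCanon lx lz a b = true) : checkConfig lx lz a b = true := by
  have h := checkAll_eq_true
  unfold checkAll at h
  rw [List.all_eq_true] at h
  have h := h lx (List.mem_range.2 hlx)
  rw [List.all_eq_true] at h
  have h := h lz (List.mem_range.2 hlz)
  rw [if_pos h1, List.all_eq_true] at h
  have h := h a (List.mem_range.2 ha)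
  rw [if_pos h2, List.all_eq_true] at h
  have h := h b (List.mem_range.2 hb)
  rw [if_pos ⟨h3, h4⟩, checkIfCanon, if_pos hc] at h
  exact h

/-! ### Soundness -/

section sound

/-- `bothTab` lookup. [this work] -/
theorem bothTab_get {LX LZ : Finset (Fin 5)} :
    bothTab.getD (encS LX * 32 + encS LZ) 0 = encE (pairsIn (LX ∩ LZ)) := by
  obtain ⟨hX, hX'⟩ := decodeSet_encS LX
  obtain ⟨hZ, hZ'⟩ := decodeSet_encS LZ
  rw [bothTab, getD_ofFn _ _ (by omega)]
  dsimp only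
  rw [show (encS LX * 32 + encS LZ) / 32 = encS LX by omega, show (encS LX * 32 + encS LZ) % 32 = encS LZ by omega, hX, hZ]

/-- Swapping `X ↔ Z` preserves validity. [this work] -/
theorem valid_swap {LX LZ : Finset (Fin 5)} {A B : Finset (Finset (Fin 5))}
    (h : LX ∪ LZ = univ ∧ A ⊆ pairsIn (LX ∩ LZ) ∧ B ⊆ pairsIn (LX ∩ LZ) ∧ pairsIn (LX ∩ LZ) ⊆ A ∪ B) :
    LZ ∪ LX = univ ∧ B ⊆ pairsIn (LZ ∩ LX) ∧ A ⊆ pairsIn (LZ ∩ LX) ∧ pairsIn (LZ ∩ LX) ⊆ B ∪ A := by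
  obtain ⟨h1, h2, h3, h4⟩ := h
  rw [union_comm] at h1; rw [inter_comm] at h2 h3 h4; rw [union_comm] at h4
  exact ⟨h1, h3, h2, h4⟩

/-- **Soundness of the symmetric enumeration**: every valid flag configuration on `Fin 5` has `Ñ₂ ∈ ℕ[r]`. [this work] -/
theorem flagGood_of_code : ∀ (c : ℕ) (LX LZ : Finset (Fin 5)) (A B : Finset (Finset (Fin 5))),
    code (encS LX) (encS LZ) (encE A) (encE B) = c →
    (LX ∪ LZ = univ ∧ A ⊆ pairsIn (LX ∩ LZ) ∧ B ⊆ pairsIn (LX ∩ LZ) ∧ pairsIn (LX ∩ LZ) ⊆ A ∪ B) →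
    ∀ n, 0 ≤ (N2gen (flagCx LX (privPairs LX LZ ∪ A)) (flagCx LZ (privPairs LZ LX ∪ B))).coeff n := by
  intro c
  induction c using Nat.strong_induction_on with
  | _ c ih =>
  intro LX LZ A B hc hv
  obtain ⟨h1, h2, h3, h4⟩ := hv
  obtain ⟨dX, lX⟩ := decodeSet_encS LX
  obtain ⟨dZ, lZ⟩ := decodeSet_encS LZ
  have dA := decodeEdges_encE (subset_pairsIn_univ h2)
  have lA := encE_lt A
  have dB := decodeEdges_encE (subset_pairsIn_univ h3)
  have lB := encE_lt B
  by_cases hcan : isCanon (encS LX) (encS LZ) (encE A) (encE B) = true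
  · -- canonical: the table check was run
    have hchk := checkConfig_of_checkAll lX lZ lA lB (mask_union h1) (by rw [bothTab_get]; exact mask_subset h2)
      (by rw [bothTab_get]; exact mask_subset h3) (by rw [bothTab_get]; exact mask_cover h2 h3 h4) hcan
    rw [checkConfig, cxX, cxZ, dX, dZ, dA, dB] at hchk
    exact coeff_N2gen_nonneg_of_tabNonneg hchk
  · -- not canonical: some relabelling (possibly swapped) has a smaller code
    rw [isCanon, Bool.not_eq_true, List.all_eq_false] at hcan
    obtain ⟨T, hT, hlt⟩ := hcan
    obtain ⟨σ, _, rfl⟩ := List.mem_map.1 hT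
    simp only [permTab, getD_ofFn _ _ lX, getD_ofFn _ _ lZ, getD_ofFn _ _ lA, getD_ofFn _ _ lB, dX, dZ, dA, dB, Bool.and_eq_true,
      decide_eq_true_eq, not_and_or, not_le] at hlt
    have hv' := flagValid_map σ h1 h2 h3 h4
    rcases hlt with hlt | hlt
    · exact flagGood_of_map σ (ih _ (hc ▸ hlt) _ _ _ _ rfl hv')
    · exact flagGood_of_map σ (flagGood_swap (ih _ (hc ▸ hlt) _ _ _ _ rfl (valid_swap hv')))

end sound

/-- **THE c = 2 COEFFICIENTWISE THRESHOLD CERTIFICATE ON FIVE POINTS.**  For all simplicial complexes (down-sets containing `∅`) `K_X, K_Z` on `Fin 5`,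
every coefficient of `Ñ₂(K_X, K_Z)` is nonnegative. [this work] -/
theorem coeff_N2gen_nonneg_fin5 {KX KZ : Finset (Finset (Fin 5))} (hKX : IsLowerSet (KX : Set (Finset (Fin 5))))
    (hKZ : IsLowerSet (KZ : Set (Finset (Fin 5)))) (h0X : ∅ ∈ KX) (h0Z : ∅ ∈ KZ) (n : Fin 5 →₀ ℕ) : 0 ≤ (N2gen KX KZ).coeff n :=
  coeff_N2gen_nonneg_of_configs (fun LX LZ A B h1 h2 h3 h4 => flagGood_of_code _ LX LZ A B rfl ⟨h1, h2, h3, h4⟩) hKX hKZ h0X h0Z n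

/-- **Value-level corollary**: `Ñ₂(K_X,K_Z)(r) ≥ 0` at every `r ≥ 0` — the `(TC)` row of the c = 2 threshold certificate holds at every odds vector
for every pair of complexes on five points. [this work] -/
theorem eval_N2gen_nonneg_fin5 {KX KZ : Finset (Finset (Fin 5))} (hKX : IsLowerSet (KX : Set (Finset (Fin 5))))
    (hKZ : IsLowerSet (KZ : Set (Finset (Fin 5)))) (h0X : ∅ ∈ KX) (h0Z : ∅ ∈ KZ) (r : Fin 5 → ℝ) (hr : ∀ i, 0 ≤ r i) :
    0 ≤ MvPolynomial.eval₂ (Int.castRingHom ℝ) r (N2gen KX KZ) := by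
  have h := eval_le_of_coeff_le (P := 0) (Q := N2gen KX KZ) (fun m => by rw [coeff_zero]; exact coeff_N2gen_nonneg_fin5 hKX hKZ h0X h0Z m) r hr
  rwa [MvPolynomial.eval₂_zero] at h

end N2Five

end Summit.CriticalPhenomena.PercolationContinuityZ3.Theorems.SahiCTCForms
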